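import Literature.Analysis.FluidPDE.QuasiSelfSimilarGeneratorMoves
import HarnessLib

/-!
# Generator moves by phases: slot-wise clauses, time gluing, static extension

Topic `Literature/Analysis/FluidPDE`. Consumer-end bookkeeping for a discharge of
`acm_compatible_blocks` (`QuasiSelfSimilarCompatibleBlocks.lean`) through
`acm_compatible_blocks_of_generator_moves[_peano]` (`QuasiSelfSimilarGeneratorMoves.lean`). The two
explicit isotopies of Alberti–Crippa–Mazzucato (J. AMS 32 (2019), §8: the straight channel is bent
into the `5 × 5` "snake", the bent channel likewise) are built in STAGES — a first stage producing
the coarse pattern by `t = 1/2`, then finer adjustments (ACM §8.9–8.11) — and an explicit design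
(`PlanarChainMove.lean`: all clauses of a generator move for a chain of elements on a time SLOT
`S × Q`) naturally proves the clauses of `IsGeneratorMove` phase by phase, each phase with its own
description of the channel. This file turns such phase-wise information into a generator move:

* `IsGeneratorMoveOn S V Θ gate Vg Θg δ` — the clauses of `IsGeneratorMove` with every pointwise
  clause (incompressibility, tangency, transport, the bound, the boundary strips, the gate
  windows) asked only for times `t ∈ S`; smoothness stays global. `IsGeneratorMoveOn.mono`,
  `IsGeneratorMove.moveOn` (`S = [0,1]` for the PDE clauses), `IsGeneratorMoveOn.toMove`
  (`S = univ` gives a generator move), `IsGeneratorMoveOn.congr` (fields agreeing near `S`);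
* **time gluing** (`timeGlue b f g t = if t ≤ b then f t else g t`): two phases which COINCIDE on
  an open time window `(b - ε, b + ε)` around the cut glue to smooth fields
  (`contDiff_uncurry_timeGlue`), with the expected slices and time derivatives
  (`timeGlue_of_le`, `timeGlue_of_lt`, `deriv_timeGlue_of_lt`, `deriv_timeGlue_of_gt`), and
  phase-wise clauses glue: `IsGeneratorMoveOn.glue` (general time sets), `IsGeneratorMoveOn.glue_Icc`
  (`[a,b]` and `[b,c]` give `[a,c]`). In the designs consecutive phases are static near the cut
  (flat clocks, `PlanarChainChecks.clock`) and describe the same configuration there, which is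
  exactly the agreement hypothesis; gluing is iterated one cut at a time;
* **static extension** (`IsGeneratorMoveOn.toMove_of_static`): clauses on `[0,1]` plus fields and
  gate fields frozen before `t = 0` and after `t = 1` give `IsGeneratorMove` (whose boundary-strip
  and gate-window clauses are asked at all times).

Folklore; the file states no named fact (net debt `0`).

## References

* G. Alberti, G. Crippa, A. L. Mazzucato, *Exponential self-similar mixing by incompressible
  flows*, J. Amer. Math. Soc. 32 (2019), 445–490, §8.9–8.11 (arXiv:1605.02090) — the staged moves.
* E. Bruè, C. De Lellis, *Anomalous dissipation for the forced 3D Navier–Stokes equations*,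
  Comm. Math. Phys. 400 (2023), §4.1 — the block structure served.
-/

noncomputable section

open MeasureTheory Set Filter Function
open scoped ContDiff Topology

namespace Literature.Analysis.FluidPDE

namespace QuasiSelfSimilar

open FunctionSpaces FunctionSpaces.Torus

/-! ## Slot-wise clauses -/

/-- **Generator move on a set of times** `S`: the clauses of `IsGeneratorMove` — smooth fields on
`ℝ × ℝ²`; on `S × [0,1]²` incompressible, tangent to the boundary, transporting the scalar, with
`|Θ| ≤ 10`; for `t ∈ S` the vanishing on the boundary strips away from the gate windows and the
agreement with the universal gate fields inside the gate windows — with every pointwise clause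
restricted to times `t ∈ S` (a phase of a staged move, ACM 2019 §8.9–8.11). [folklore] -/
structure IsGeneratorMoveOn (S : Set ℝ) (V : ℝ → EuclideanSpace ℝ (Fin 2) → EuclideanSpace ℝ (Fin 2))
    (Θ : ℝ → EuclideanSpace ℝ (Fin 2) → ℝ) (gate : Fin 2 → Bool → Bool)
    (Vg : Fin 2 → ℝ → EuclideanSpace ℝ (Fin 2) → EuclideanSpace ℝ (Fin 2))
    (Θg : Fin 2 → ℝ → EuclideanSpace ℝ (Fin 2) → ℝ) (δ : ℝ) : Prop where
  /-- `V ∈ C^∞(ℝ × ℝ²)`. -/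
  smooth_velocity : ContDiff ℝ ∞ (uncurry V)
  /-- `Θ ∈ C^∞(ℝ × ℝ²)`. -/
  smooth_scalar : ContDiff ℝ ∞ (uncurry Θ)
  /-- `div V(t) = 0` on `S × [0,1]²`. -/
  divFree : ∀ t ∈ S, ∀ z ∈ closedSquare, ∑ j, fderiv ℝ (V t) z (EuclideanSpace.single j 1) j = 0
  /-- `V(t)` is tangent to `∂[0,1]²` for `t ∈ S`. -/
  tangent : ∀ t ∈ S, ∀ z ∈ closedSquare, ∀ j, (z j = 0 ∨ z j = 1) → V t z j = 0
  /-- transport `∂ₜΘ + DΘ[V] = 0` on `S × [0,1]²`. -/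
  transport : ∀ t ∈ S, ∀ z ∈ closedSquare, deriv (fun s => Θ s z) t + fderiv ℝ (Θ t) z (V t z) = 0
  /-- `|Θ| ≤ 10` on `S × [0,1]²`. -/
  abs_le : ∀ t ∈ S, ∀ z ∈ closedSquare, |Θ t z| ≤ 10
  /-- vanishing on the boundary strips away from the gate windows, for `t ∈ S`. -/
  vanish : ∀ t ∈ S, ∀ (z : EuclideanSpace ℝ (Fin 2)) (k : Fin 2) (s : Bool),
    |z k - faceValue s| < δ → (¬ gate k s = true ∨ ∃ j, j ≠ k ∧ δ ≤ |z j - 2⁻¹|) → V t z = 0 ∧ Θ t z = 0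
  /-- agreement with the gate field inside the gate windows, for `t ∈ S`. -/
  eq_gate : ∀ t ∈ S, ∀ (z : EuclideanSpace ℝ (Fin 2)) (k : Fin 2) (s : Bool), gate k s = true →
    |z k - faceValue s| < δ → (∀ j, j ≠ k → |z j - 2⁻¹| < 2 * δ) →
      V t z = Vg k t (z - faceMidpoint k s) ∧ Θ t z = Θg k t (z - faceMidpoint k s)

section Basic

variable {S S' : Set ℝ} {V : ℝ → EuclideanSpace ℝ (Fin 2) → EuclideanSpace ℝ (Fin 2)}
  {Θ : ℝ → EuclideanSpace ℝ (Fin 2) → ℝ} {gate : Fin 2 → Bool → Bool}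
  {Vg : Fin 2 → ℝ → EuclideanSpace ℝ (Fin 2) → EuclideanSpace ℝ (Fin 2)}
  {Θg : Fin 2 → ℝ → EuclideanSpace ℝ (Fin 2) → ℝ} {δ : ℝ}

/-- **Restriction of the time set.** [folklore] -/
theorem IsGeneratorMoveOn.mono (h : IsGeneratorMoveOn S V Θ gate Vg Θg δ) (hS : S' ⊆ S) :
    IsGeneratorMoveOn S' V Θ gate Vg Θg δ where
  smooth_velocity := h.smooth_velocity
  smooth_scalar := h.smooth_scalar
  divFree t ht := h.divFree t (hS ht)
  tangent t ht := h.tangent t (hS ht)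
  transport t ht := h.transport t (hS ht)
  abs_le t ht := h.abs_le t (hS ht)
  vanish t ht := h.vanish t (hS ht)
  eq_gate t ht := h.eq_gate t (hS ht)

/-- **A generator move is a generator move on `[0,1]`.** [folklore] -/
theorem IsGeneratorMove.moveOn (h : IsGeneratorMove V Θ gate Vg Θg δ) :
    IsGeneratorMoveOn (Icc 0 1) V Θ gate Vg Θg δ where
  smooth_velocity := h.smooth_velocity
  smooth_scalar := h.smooth_scalar
  divFree := h.divFree
  tangent := h.tangent
  transport := h.transport
  abs_le := h.abs_le
  vanish t _ := h.vanish t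
  eq_gate t _ := h.eq_gate t

/-- **A generator move on all times is a generator move.** [folklore] -/
theorem IsGeneratorMoveOn.toMove (h : IsGeneratorMoveOn univ V Θ gate Vg Θg δ) :
    IsGeneratorMove V Θ gate Vg Θg δ where
  smooth_velocity := h.smooth_velocity
  smooth_scalar := h.smooth_scalar
  divFree t _ := h.divFree t (mem_univ t)
  tangent t _ := h.tangent t (mem_univ t)
  transport t _ := h.transport t (mem_univ t)
  abs_le t _ := h.abs_le t (mem_univ t)
  vanish t := h.vanish t (mem_univ t)
  eq_gate t := h.eq_gate t (mem_univ t)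

/-- **Static extension**: a generator move on `[0,1]` whose fields, and the gate fields, are frozen
before `t = 0` and after `t = 1` (as for designs run by flat clocks) is a generator move — the
boundary-strip and gate-window clauses transfer to all times by freezing. [folklore] -/
theorem IsGeneratorMoveOn.toMove_of_static (h : IsGeneratorMoveOn (Icc 0 1) V Θ gate Vg Θg δ)
    (hV₀ : ∀ t ≤ (0 : ℝ), V t = V 0) (hΘ₀ : ∀ t ≤ (0 : ℝ), Θ t = Θ 0)
    (hV₁ : ∀ t, (1 : ℝ) ≤ t → V t = V 1) (hΘ₁ : ∀ t, (1 : ℝ) ≤ t → Θ t = Θ 1)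
    (hVg₀ : ∀ k, ∀ t ≤ (0 : ℝ), Vg k t = Vg k 0) (hΘg₀ : ∀ k, ∀ t ≤ (0 : ℝ), Θg k t = Θg k 0)
    (hVg₁ : ∀ k t, (1 : ℝ) ≤ t → Vg k t = Vg k 1) (hΘg₁ : ∀ k t, (1 : ℝ) ≤ t → Θg k t = Θg k 1) :
    IsGeneratorMove V Θ gate Vg Θg δ where
  smooth_velocity := h.smooth_velocity
  smooth_scalar := h.smooth_scalar
  divFree := h.divFree
  tangent := h.tangent
  transport := h.transport
  abs_le := h.abs_le
  vanish t z k s h1 h2 := by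
    rcases le_total t 0 with ht | ht
    · rw [hV₀ t ht, hΘ₀ t ht]
      exact h.vanish 0 ⟨le_rfl, zero_le_one⟩ z k s h1 h2
    rcases le_total t 1 with ht' | ht'
    · exact h.vanish t ⟨ht, ht'⟩ z k s h1 h2
    · rw [hV₁ t ht', hΘ₁ t ht']
      exact h.vanish 1 ⟨zero_le_one, le_rfl⟩ z k s h1 h2
  eq_gate t z k s hg h1 h2 := by
    rcases le_total t 0 with ht | ht
    · rw [hV₀ t ht, hΘ₀ t ht, hVg₀ k t ht, hΘg₀ k t ht]
      exact h.eq_gate 0 ⟨le_rfl, zero_le_one⟩ z k s hg h1 h2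
    rcases le_total t 1 with ht' | ht'
    · exact h.eq_gate t ⟨ht, ht'⟩ z k s hg h1 h2
    · rw [hV₁ t ht', hΘ₁ t ht', hVg₁ k t ht', hΘg₁ k t ht']
      exact h.eq_gate 1 ⟨zero_le_one, le_rfl⟩ z k s hg h1 h2

/-- **Replacing the fields by others agreeing near `S`**: if smooth fields `(V', Θ')` coincide with
`(V, Θ)` at all times of an open set `U ⊇ S`, the clauses on `S` transfer (the time derivative in
the transport clause only sees a neighbourhood of `t ∈ S`). Used to replace a glued or assembled
formula by a closed one. [folklore] -/
theorem IsGeneratorMoveOn.congr {U : Set ℝ} {V' : ℝ → EuclideanSpace ℝ (Fin 2) → EuclideanSpace ℝ (Fin 2)}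
    {Θ' : ℝ → EuclideanSpace ℝ (Fin 2) → ℝ}
    (h : IsGeneratorMoveOn S V Θ gate Vg Θg δ) (hV' : ContDiff ℝ ∞ (uncurry V'))
    (hΘ' : ContDiff ℝ ∞ (uncurry Θ')) (hU : IsOpen U) (hSU : S ⊆ U) (hV : ∀ t ∈ U, V' t = V t)
    (hΘ : ∀ t ∈ U, Θ' t = Θ t) : IsGeneratorMoveOn S V' Θ' gate Vg Θg δ where
  smooth_velocity := hV'
  smooth_scalar := hΘ'
  divFree t ht := by rw [hV t (hSU ht)]; exact h.divFree t ht
  tangent t ht := by rw [hV t (hSU ht)]; exact h.tangent t ht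
  transport t ht z hz := by
    have e : deriv (fun s => Θ' s z) t = deriv (fun s => Θ s z) t := by
      refine Filter.EventuallyEq.deriv_eq (Filter.eventually_of_mem (hU.mem_nhds (hSU ht)) fun s hs => ?_)
      simp only
      rw [hΘ s hs]
    rw [e, hΘ t (hSU ht), hV t (hSU ht)]
    exact h.transport t ht z hz
  abs_le t ht := by rw [hΘ t (hSU ht)]; exact h.abs_le t ht
  vanish t ht := by rw [hV t (hSU ht), hΘ t (hSU ht)]; exact h.vanish t ht
  eq_gate t ht := by rw [hV t (hSU ht), hΘ t (hSU ht)]; exact h.eq_gate t ht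

end Basic

/-! ## Time gluing of two phases -/

section Glue

variable {α : Type*}

/-- **Time gluing** at the cut `b`: the first phase up to and including `t = b`, the second phase
after. [folklore] -/
def timeGlue (b : ℝ) (f g : ℝ → α) (t : ℝ) : α := if t ≤ b then f t else g t

/-- Before the cut the glued family is the first phase. [folklore] -/
theorem timeGlue_of_le {b : ℝ} (f g : ℝ → α) {t : ℝ} (ht : t ≤ b) : timeGlue b f g t = f t := by
  simp [timeGlue, ht]

/-- After the cut the glued family is the second phase. [folklore] -/
theorem timeGlue_of_lt {b : ℝ} (f g : ℝ → α) {t : ℝ} (ht : b < t) : timeGlue b f g t = g t := by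
  simp [timeGlue, not_le.2 ht]

/-- With agreement on `(b - ε, b + ε)`, the glued family is the first phase on `(-∞, b + ε)`.
[folklore] -/
theorem timeGlue_eq_left {b ε : ℝ} {f g : ℝ → α} (hfg : ∀ t ∈ Ioo (b - ε) (b + ε), f t = g t) {t : ℝ}
    (ht : t < b + ε) : timeGlue b f g t = f t := by
  by_cases h : t ≤ b
  · exact timeGlue_of_le f g h
  · rw [timeGlue_of_lt f g (not_le.1 h), hfg t ⟨by linarith [not_le.1 h], ht⟩]

/-- With agreement on `(b - ε, b + ε)`, the glued family is the second phase on `(b - ε, ∞)`.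
[folklore] -/
theorem timeGlue_eq_right {b ε : ℝ} {f g : ℝ → α} (hfg : ∀ t ∈ Ioo (b - ε) (b + ε), f t = g t) {t : ℝ}
    (ht : b - ε < t) : timeGlue b f g t = g t := by
  by_cases h : t ≤ b
  · rw [timeGlue_of_le f g h, hfg t ⟨ht, by linarith⟩]
  · exact timeGlue_of_lt f g (not_le.1 h)

/-- Either `t < b + ε` or `b - ε < t` (for `ε > 0`, both may hold). [folklore] -/
theorem lt_add_or_sub_lt (b ε t : ℝ) (hε : 0 < ε) : t < b + ε ∨ b - ε < t := by
  by_cases h : t < b + ε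
  · exact Or.inl h
  · exact Or.inr (by linarith [not_lt.1 h])

variable {E F : Type*} [NormedAddCommGroup E] [NormedSpace ℝ E] [NormedAddCommGroup F] [NormedSpace ℝ F]

/-- **The time gluing of two smooth families agreeing on an open window around the cut is smooth**
(jointly in `(t, z)`): near a point with `t < b + ε` the glued family is the first phase, near a
point with `t > b - ε` the second. [folklore] -/
theorem contDiff_uncurry_timeGlue {n : WithTop ℕ∞} {b ε : ℝ} (hε : 0 < ε) {f g : ℝ → E → F}
    (hf : ContDiff ℝ n (uncurry f)) (hg : ContDiff ℝ n (uncurry g))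
    (hfg : ∀ t ∈ Ioo (b - ε) (b + ε), f t = g t) : ContDiff ℝ n (uncurry (timeGlue b f g)) := by
  refine contDiff_iff_contDiffAt.2 fun p => ?_
  rcases lt_add_or_sub_lt b ε p.1 hε with hp | hp
  · have hopen : IsOpen {q : ℝ × E | q.1 < b + ε} := isOpen_lt continuous_fst continuous_const
    refine hf.contDiffAt.congr_of_eventuallyEq (Filter.eventually_of_mem (hopen.mem_nhds hp) ?_)
    rintro ⟨t, z⟩ (ht : t < b + ε)
    simp only [uncurry_apply_pair]
    rw [timeGlue_eq_left hfg ht]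
  · have hopen : IsOpen {q : ℝ × E | b - ε < q.1} := isOpen_lt continuous_const continuous_fst
    refine hg.contDiffAt.congr_of_eventuallyEq (Filter.eventually_of_mem (hopen.mem_nhds hp) ?_)
    rintro ⟨t, z⟩ (ht : b - ε < t)
    simp only [uncurry_apply_pair]
    rw [timeGlue_eq_right hfg ht]

omit [NormedAddCommGroup E] [NormedSpace ℝ E] in
/-- **Time derivative of the glued family before `b + ε`** is that of the first phase. [folklore] -/
theorem deriv_timeGlue_of_lt {b ε : ℝ} {f g : ℝ → E → F} (hfg : ∀ t ∈ Ioo (b - ε) (b + ε), f t = g t)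
    {t : ℝ} (ht : t < b + ε) (z : E) :
    deriv (fun s => timeGlue b f g s z) t = deriv (fun s => f s z) t := by
  refine Filter.EventuallyEq.deriv_eq (Filter.eventually_of_mem (Iio_mem_nhds ht) fun s hs => ?_)
  simp only
  rw [timeGlue_eq_left hfg hs]

omit [NormedAddCommGroup E] [NormedSpace ℝ E] in
/-- **Time derivative of the glued family after `b - ε`** is that of the second phase. [folklore] -/
theorem deriv_timeGlue_of_gt {b ε : ℝ} {f g : ℝ → E → F} (hfg : ∀ t ∈ Ioo (b - ε) (b + ε), f t = g t)
    {t : ℝ} (ht : b - ε < t) (z : E) :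
    deriv (fun s => timeGlue b f g s z) t = deriv (fun s => g s z) t := by
  refine Filter.EventuallyEq.deriv_eq (Filter.eventually_of_mem (Ioi_mem_nhds ht) fun s hs => ?_)
  simp only
  rw [timeGlue_eq_right hfg hs]

end Glue

section GlueMoves

variable {S₁ S₂ : Set ℝ} {V₁ V₂ : ℝ → EuclideanSpace ℝ (Fin 2) → EuclideanSpace ℝ (Fin 2)}
  {Θ₁ Θ₂ : ℝ → EuclideanSpace ℝ (Fin 2) → ℝ} {gate : Fin 2 → Bool → Bool}
  {Vg : Fin 2 → ℝ → EuclideanSpace ℝ (Fin 2) → EuclideanSpace ℝ (Fin 2)}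
  {Θg : Fin 2 → ℝ → EuclideanSpace ℝ (Fin 2) → ℝ} {δ b ε : ℝ}

/-- **Gluing two phases of a generator move.** Two phases `(V₁, Θ₁)` on the times `S₁` and
`(V₂, Θ₂)` on the times `S₂`, with the same gates, gate fields and margin, which coincide on an
open time window `(b - ε, b + ε)` around the cut, glue to a phase on the set of times `t` with
`t ∈ S₁` if `t ≤ b` and `t ∈ S₂` if `t > b`. [folklore] -/
theorem IsGeneratorMoveOn.glue (hε : 0 < ε) (h₁ : IsGeneratorMoveOn S₁ V₁ Θ₁ gate Vg Θg δ)
    (h₂ : IsGeneratorMoveOn S₂ V₂ Θ₂ gate Vg Θg δ)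
    (hV : ∀ t ∈ Ioo (b - ε) (b + ε), V₁ t = V₂ t) (hΘ : ∀ t ∈ Ioo (b - ε) (b + ε), Θ₁ t = Θ₂ t) :
    IsGeneratorMoveOn {t | (t ≤ b → t ∈ S₁) ∧ (b < t → t ∈ S₂)} (timeGlue b V₁ V₂) (timeGlue b Θ₁ Θ₂)
      gate Vg Θg δ where
  smooth_velocity := contDiff_uncurry_timeGlue hε h₁.smooth_velocity h₂.smooth_velocity hV
  smooth_scalar := contDiff_uncurry_timeGlue hε h₁.smooth_scalar h₂.smooth_scalar hΘ
  divFree t ht z hz := by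
    rcases le_or_gt t b with htb | htb
    · rw [timeGlue_of_le V₁ V₂ htb]; exact h₁.divFree t (ht.1 htb) z hz
    · rw [timeGlue_of_lt V₁ V₂ htb]; exact h₂.divFree t (ht.2 htb) z hz
  tangent t ht z hz := by
    rcases le_or_gt t b with htb | htb
    · rw [timeGlue_of_le V₁ V₂ htb]; exact h₁.tangent t (ht.1 htb) z hz
    · rw [timeGlue_of_lt V₁ V₂ htb]; exact h₂.tangent t (ht.2 htb) z hz
  transport t ht z hz := by
    rcases le_or_gt t b with htb | htb
    · rw [deriv_timeGlue_of_lt hΘ (by linarith) z, timeGlue_of_le Θ₁ Θ₂ htb, timeGlue_of_le V₁ V₂ htb]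
      exact h₁.transport t (ht.1 htb) z hz
    · rw [deriv_timeGlue_of_gt hΘ (by linarith) z, timeGlue_of_lt Θ₁ Θ₂ htb, timeGlue_of_lt V₁ V₂ htb]
      exact h₂.transport t (ht.2 htb) z hz
  abs_le t ht z hz := by
    rcases le_or_gt t b with htb | htb
    · rw [timeGlue_of_le Θ₁ Θ₂ htb]; exact h₁.abs_le t (ht.1 htb) z hz
    · rw [timeGlue_of_lt Θ₁ Θ₂ htb]; exact h₂.abs_le t (ht.2 htb) z hz
  vanish t ht z k s ha hb := by
    rcases le_or_gt t b with htb | htb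
    · rw [timeGlue_of_le V₁ V₂ htb, timeGlue_of_le Θ₁ Θ₂ htb]; exact h₁.vanish t (ht.1 htb) z k s ha hb
    · rw [timeGlue_of_lt V₁ V₂ htb, timeGlue_of_lt Θ₁ Θ₂ htb]; exact h₂.vanish t (ht.2 htb) z k s ha hb
  eq_gate t ht z k s hg ha hb := by
    rcases le_or_gt t b with htb | htb
    · rw [timeGlue_of_le V₁ V₂ htb, timeGlue_of_le Θ₁ Θ₂ htb]; exact h₁.eq_gate t (ht.1 htb) z k s hg ha hb
    · rw [timeGlue_of_lt V₁ V₂ htb, timeGlue_of_lt Θ₁ Θ₂ htb]; exact h₂.eq_gate t (ht.2 htb) z k s hg ha hb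

/-- **Gluing consecutive time intervals**: phases on `[a, b]` and on `[b, c]` coinciding on
`(b - ε, b + ε)` glue to a phase on `[a, c]`. Iterating, finitely many phases on consecutive
intervals covering `[0, 1]` glue to a phase on `[0, 1]`. [folklore] -/
theorem IsGeneratorMoveOn.glue_Icc {a c : ℝ} (hε : 0 < ε) (h₁ : IsGeneratorMoveOn (Icc a b) V₁ Θ₁ gate Vg Θg δ)
    (h₂ : IsGeneratorMoveOn (Icc b c) V₂ Θ₂ gate Vg Θg δ)
    (hV : ∀ t ∈ Ioo (b - ε) (b + ε), V₁ t = V₂ t) (hΘ : ∀ t ∈ Ioo (b - ε) (b + ε), Θ₁ t = Θ₂ t) :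
    IsGeneratorMoveOn (Icc a c) (timeGlue b V₁ V₂) (timeGlue b Θ₁ Θ₂) gate Vg Θg δ :=
  (h₁.glue hε h₂ hV hΘ).mono fun _ ht => ⟨fun htb => ⟨ht.1, htb⟩, fun htb => ⟨htb.le, ht.2⟩⟩

/-- **Gluing half-lines**: phases on `(-∞, b]` and on `[b, ∞)` coinciding on `(b - ε, b + ε)` glue
to a phase on all times, hence (`IsGeneratorMoveOn.toMove`) to a generator move. [folklore] -/
theorem IsGeneratorMoveOn.glue_Iic_Ici (hε : 0 < ε) (h₁ : IsGeneratorMoveOn (Iic b) V₁ Θ₁ gate Vg Θg δ)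
    (h₂ : IsGeneratorMoveOn (Ici b) V₂ Θ₂ gate Vg Θg δ)
    (hV : ∀ t ∈ Ioo (b - ε) (b + ε), V₁ t = V₂ t) (hΘ : ∀ t ∈ Ioo (b - ε) (b + ε), Θ₁ t = Θ₂ t) :
    IsGeneratorMoveOn univ (timeGlue b V₁ V₂) (timeGlue b Θ₁ Θ₂) gate Vg Θg δ :=
  (h₁.glue hε h₂ hV hΘ).mono fun _ _ => ⟨fun htb => htb, fun htb => htb.le⟩

/-- **Gluing at the initial slice of the glued move**: for `0 ≤ b` the glued scalar at `t = 0` is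
the first phase's (so the normalisations of a generator BLOCK, `IsGeneratorMove.toBlock`, are
those of the first phase's initial datum). [folklore] -/
theorem timeGlue_zero_of_nonneg {α : Type*} (f g : ℝ → α) (hb : 0 ≤ b) : timeGlue b f g 0 = f 0 :=
  timeGlue_of_le f g hb

/-- **Gluing at the final slice**: for `b < 1` the glued family at `t = 1` is the second phase's
(so the cell identities at `t = 1` are those of the last phase). [folklore] -/
theorem timeGlue_one_of_lt {α : Type*} (f g : ℝ → α) (hb : b < 1) : timeGlue b f g 1 = g 1 :=
  timeGlue_of_lt f g hb

end GlueMoves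

end QuasiSelfSimilar

end Literature.Analysis.FluidPDE

end
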